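import Mathlib

/-!
# The Euler step of ENGINE v16 'EIGENSCAN' (HodgeConjecture / FermatCycles cell, ftc-engine gen-19)

HONEST FRAMING: explicit algebraic cycles for specific Hodge classes on Fermat/Delsarte varieties;
residual open instances listed; no claim on general Hodge.

The Ψ-eigenscan (FAMILY-H §H.25 (g2), memo `ftc/certs/W69/EIGENSCAN.md` §1 (E1)) looks for the
singular points of the degree-`6e` hypersurfaces `Ψ_G = {f = G ^ 6}` (`f` homogeneous of degree
`6e`, `G` homogeneous of degree `e`; in the cell `e = 4`).  Off `{G = 0}` the engine only imposes the
GRADIENT condition `∂ᵢ f = 6 G⁵ ∂ᵢ G` and never the equation `f = G⁶` itself: by Euler's identity for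
homogeneous polynomials the equation follows from the gradient condition at every point, in any
characteristic prime to `6e`.  This file records exactly that step (pointwise, for evaluations at
a point `z`), from Mathlib's `MvPolynomial.IsHomogeneous.sum_X_mul_pderiv`.
-/

namespace Summit.HodgeConjecture.FermatCycles.EigenscanEuler

open MvPolynomial

variable {K : Type*} [Field K] {σ : Type*} [Fintype σ]

/-- Euler's identity evaluated at a point: `∑ᵢ zᵢ (∂ᵢ φ)(z) = n • φ(z)` for `φ` homogeneous of
degree `n`. -/
theorem eval_euler {φ : MvPolynomial σ K} {n : ℕ} (hφ : φ.IsHomogeneous n) (z : σ → K) :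
    ∑ i, z i * eval z (pderiv i φ) = (n : K) * eval z φ := by
  have h := congrArg (eval z) hφ.sum_X_mul_pderiv
  simp only [map_sum, map_mul, eval_X, nsmul_eq_mul, map_natCast] at h
  exact h

/-- (E1) of the memo: if `f` is homogeneous of degree `6 e`, `G` homogeneous of degree `e`,
`6 e ≠ 0` in `K`, and at the point `z` the gradient condition `∂ᵢ f (z) = 6 G(z)⁵ ∂ᵢ G (z)` holds
for every variable, then `f (z) = G (z) ^ 6`: the point lies on `Ψ_G` automatically. -/
theorem eval_eq_pow_six_of_gradient {f G : MvPolynomial σ K} {e : ℕ}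
    (hf : f.IsHomogeneous (6 * e)) (hG : G.IsHomogeneous e) (he : ((6 * e : ℕ) : K) ≠ 0)
    (z : σ → K) (h : ∀ i, eval z (pderiv i f) = 6 * eval z G ^ 5 * eval z (pderiv i G)) :
    eval z f = eval z G ^ 6 := by
  have hEf := eval_euler hf z
  have hEG := eval_euler hG z
  have key : ((6 * e : ℕ) : K) * eval z f = ((6 * e : ℕ) : K) * eval z G ^ 6 := by
    calc ((6 * e : ℕ) : K) * eval z f = ∑ i, z i * eval z (pderiv i f) := hEf.symm
      _ = ∑ i, z i * (6 * eval z G ^ 5 * eval z (pderiv i G)) := by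
          refine Finset.sum_congr rfl fun i _ => ?_
          rw [h i]
      _ = 6 * eval z G ^ 5 * ∑ i, z i * eval z (pderiv i G) := by
          rw [Finset.mul_sum]
          refine Finset.sum_congr rfl fun i _ => ?_
          ring
      _ = 6 * eval z G ^ 5 * ((e : K) * eval z G) := by rw [hEG]
      _ = ((6 * e : ℕ) : K) * eval z G ^ 6 := by push_cast; ring
  exact mul_left_cancel₀ he key

/-- The form used by the scan: the gradient condition with `G` replaced by `λ • G` reads
`∂ᵢ f = 6 λ⁶ G⁵ ∂ᵢ G`; so at a point with `G(z) ≠ 0` and `f(z) = μ G(z)⁶` the admissible scalings are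
exactly `λ⁶ = μ`.  Recorded here only in the direction the engine uses: the gradient condition for
`λ • G` forces `f(z) = λ⁶ G(z)⁶`. -/
theorem eval_eq_scaled_pow_six {f G : MvPolynomial σ K} {e : ℕ} (lam : K)
    (hf : f.IsHomogeneous (6 * e)) (hG : G.IsHomogeneous e) (he : ((6 * e : ℕ) : K) ≠ 0)
    (z : σ → K)
    (h : ∀ i, eval z (pderiv i f) = 6 * eval z (C lam * G) ^ 5 * eval z (pderiv i (C lam * G))) :
    eval z f = lam ^ 6 * eval z G ^ 6 := by
  have hG' : (C lam * G).IsHomogeneous e := by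
    simpa using (isHomogeneous_C σ lam).mul hG
  have := eval_eq_pow_six_of_gradient hf hG' he z h
  simpa [mul_pow] using this

end Summit.HodgeConjecture.FermatCycles.EigenscanEuler
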